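import Literature.Analysis.Matrix.CoerciveCombesThomas

/-!
# `T4Continuum.ShellMeasurePropagatorCombesThomasPrelims` — scalar and Schur preliminaries for the second-order Combes–Thomas
# bound (`ShellMeasurePropagatorCombesThomas`): the even∕odd parts of `e^{θs} − 1`, their scaling in the lattice spacing `η`,
# Schur's test in AM–GM form, and the two entry bounds of the split Combes–Thomas perturbation
(cell `pub-balaban`, sub-cell `t4`, spine estimate NE7c (node U5b); NE7c ROUND-2 crew `t4-ne7c-formalise-*`, unit
`b2b-balaban-t4-ne7c-formalise-leaf-02` gen 13; journal NOTE N-ne7cleaf02g13-1 (2026-08-20, l.22964) for the owner's γ18 «THE FLOOR»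
memo, species (α); file 1∕2 — the theorem file `ShellMeasurePropagatorCombesThomas` imports this one; ADDITIVE — imports the tree's
`Literature/Analysis/Matrix/CoerciveCombesThomas` ONLY (for `QuadraticCombesThomas`'s range-one helpers) and touches NO host;
[folklore] real analysis ∕ finite sums; 0 `def`, 0 `def … : Prop`, 0 sorry, 0 citation tags.)

HONEST FRAMING.  Finite four-torus programme, rung (B)+1 only — NOT infinite volume, NOT a mass gap, NOT the Clay problem, NOT
summit progress.  NE7c (`T4IndicatorShell.ShellWeightBound`) is NOT PRINTED in [Balaban 1983–89] and NOT PROVED; «NE7c ⇐ the named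
binders» (trigger c3).  Elementary lemmas only; nothing of Bałaban's is asserted, cited or discharged; no census row moves.
HONEST DEPENDENCY (cell): continuum YM on T⁴ ⇐ BetaPertH ∧ nine spine estimates (0/9 proved); BetaPertH ⇐ (D1) ∧ (D4) ∧ CAP+tail;
G-an2-4 gates asym, D1 and NE2/3/4.

CONTENT.  §0: `cosh(θs) − 1 ≤ cosh θ − 1`, `|sinh(θs)| ≤ sinh θ` (`|s| ≤ 1`); `e^x = 1 + (cosh x − 1) + sinh x`; the SCALING laws
`sinh(ηθ) ≤ η sinh θ` and `cosh(ηθ) − 1 ≤ η²(cosh θ − 1)` for `0 ≤ η ≤ 1`, `θ ≥ 0` (odd part linear, even part QUADRATIC in η — the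
source of the η-uniform rate in file 2).  §1: Schur's test without square roots, `Σ_{l,k} a_l N_{lk} a_k ≤ R Σ a²` for `N ≥ 0` with
row∕column sums `≤ R`; the entry bounds `‖A_{lk}‖(cosh(θs) − 1) ≤ (cosh θ − 1)·[dist ≠ 0]‖A_{lk}‖` and
`‖A_{lk} − conj A_{kl}‖·|sinh(θs)| ≤ sinh θ·[dist ≠ 0]‖A_{lk} − conj A_{kl}‖` for `|s| ≤ dist(l,k)` and a range-one `A`; the `1`-Lipschitz
property of the distance to a SET (`abs_infDist_sub_infDist_le`, the block form's exponent).
-/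

noncomputable section

open Finset
open scoped Matrix ComplexConjugate

namespace Summit.QuantumFields.BalabanUV.T4Continuum.ShellMeasurePropagatorCombesThomasPrelims

/-! ## §0 Scalar lemmas: the even∕odd parts of `e^{θs} − 1` and their scaling in `η` -/

/-- `cosh(θs) − 1 ≤ cosh θ − 1` for `θ ≥ 0`, `|s| ≤ 1` (cosh is even and increasing in `|·|`). [folklore] -/
theorem cosh_mul_sub_one_le {θ s : ℝ} (hθ : 0 ≤ θ) (hs : |s| ≤ 1) :
    Real.cosh (θ * s) - 1 ≤ Real.cosh θ - 1 := by
  have h1 : |θ * s| ≤ |θ| := by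
    rw [abs_mul, abs_of_nonneg hθ]
    calc θ * |s| ≤ θ * 1 := mul_le_mul_of_nonneg_left hs hθ
      _ = θ := mul_one θ
  linarith [Real.cosh_le_cosh.2 h1]

/-- `|sinh(θs)| ≤ sinh θ` for `θ ≥ 0`, `|s| ≤ 1`. [folklore] -/
theorem abs_sinh_mul_le {θ s : ℝ} (hθ : 0 ≤ θ) (hs : |s| ≤ 1) :
    |Real.sinh (θ * s)| ≤ Real.sinh θ := by
  rw [Real.abs_sinh]
  refine Real.sinh_le_sinh.2 ?_
  rw [abs_mul, abs_of_nonneg hθ]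
  calc θ * |s| ≤ θ * 1 := mul_le_mul_of_nonneg_left hs hθ
    _ = θ := mul_one θ

/-- `e^x = 1 + (cosh x − 1) + sinh x`. [folklore] -/
theorem exp_eq_one_add_cosh_sub_one_add_sinh (x : ℝ) :
    Real.exp x = 1 + (Real.cosh x - 1) + Real.sinh x := by
  rw [← Real.cosh_add_sinh]; ring

/-- `sinh(ηθ) ≤ η·sinh θ` for `0 ≤ η ≤ 1`, `θ ≥ 0` (the odd part scales linearly: `ψ(t) = η sinh t − sinh(ηt)` has
`ψ′ = η(cosh t − cosh(ηt)) ≥ 0` and `ψ(0) = 0`). [folklore] -/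
theorem sinh_mul_le_mul_sinh {η θ : ℝ} (hη0 : 0 ≤ η) (hη1 : η ≤ 1) (hθ : 0 ≤ θ) :
    Real.sinh (η * θ) ≤ η * Real.sinh θ := by
  have hderiv : ∀ t : ℝ, HasDerivAt (fun t => η * Real.sinh t - Real.sinh (η * t))
      (η * Real.cosh t - Real.cosh (η * t) * (η * 1)) t := by
    intro t
    have h1 : HasDerivAt (fun t => η * Real.sinh t) (η * Real.cosh t) t :=
      (Real.hasDerivAt_sinh t).const_mul η
    have h2 : HasDerivAt (fun t => Real.sinh (η * t)) (Real.cosh (η * t) * (η * 1)) t :=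
      (Real.hasDerivAt_sinh (η * t)).comp t ((hasDerivAt_id t).const_mul η)
    exact h1.sub h2
  have hmono : Monotone (fun t => η * Real.sinh t - Real.sinh (η * t)) := by
    refine monotone_of_deriv_nonneg (fun t => (hderiv t).differentiableAt) fun t => ?_
    rw [(hderiv t).deriv]
    have hc : Real.cosh (η * t) ≤ Real.cosh t := by
      refine Real.cosh_le_cosh.2 ?_
      rw [abs_mul, abs_of_nonneg hη0]
      calc η * |t| ≤ 1 * |t| := mul_le_mul_of_nonneg_right hη1 (abs_nonneg t)
        _ = |t| := one_mul _
    nlinarith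
  have h := hmono hθ
  simp only [Real.sinh_zero, mul_zero, sub_zero] at h
  linarith

/-- `cosh x − 1 = 2 sinh(x∕2)²`. [folklore] -/
theorem cosh_sub_one_eq (x : ℝ) : Real.cosh x - 1 = 2 * Real.sinh (x / 2) ^ 2 := by
  have h := Real.cosh_two_mul (x / 2)
  rw [show 2 * (x / 2) = x by ring] at h
  rw [h, Real.cosh_sq (x / 2)]
  ring

/-- `cosh(ηθ) − 1 ≤ η²·(cosh θ − 1)` for `0 ≤ η ≤ 1`, `θ ≥ 0` (the even part scales QUADRATICALLY — the source of the
η-uniformity below). [folklore] -/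
theorem cosh_mul_sub_one_le_sq_mul {η θ : ℝ} (hη0 : 0 ≤ η) (hη1 : η ≤ 1) (hθ : 0 ≤ θ) :
    Real.cosh (η * θ) - 1 ≤ η ^ 2 * (Real.cosh θ - 1) := by
  rw [cosh_sub_one_eq, cosh_sub_one_eq θ, show η * θ / 2 = η * (θ / 2) by ring]
  have h1 : 0 ≤ Real.sinh (η * (θ / 2)) := Real.sinh_nonneg_iff.2 (by positivity)
  have h2 : Real.sinh (η * (θ / 2)) ≤ η * Real.sinh (θ / 2) :=
    sinh_mul_le_mul_sinh hη0 hη1 (by positivity)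
  have h3 : Real.sinh (η * (θ / 2)) ^ 2 ≤ (η * Real.sinh (θ / 2)) ^ 2 := pow_le_pow_left₀ h1 h2 2
  nlinarith [h3]

/-! ## §1 Schur's test in AM–GM form and the two entry bounds -/

/-- **Schur's test, quadratic-form version without square roots**: for an entrywise nonnegative kernel `N` with row sums and
column sums `≤ R`, `Σ_l Σ_k a_l N_{lk} a_k ≤ R Σ_k a_k²` (by `a_l a_k ≤ (a_l² + a_k²)∕2`). [folklore] -/
theorem sum_sum_mul_le_of_rowSum_le_of_colSum_le {ι : Type*} [Fintype ι] (N : ι → ι → ℝ)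
    (hN : ∀ l k, 0 ≤ N l k) {R : ℝ} (hrow : ∀ l, ∑ k, N l k ≤ R) (hcol : ∀ k, ∑ l, N l k ≤ R)
    (a : ι → ℝ) : ∑ l, ∑ k, a l * N l k * a k ≤ R * ∑ k, a k ^ 2 := by
  have hpt : ∀ l k, a l * N l k * a k ≤ N l k * a l ^ 2 / 2 + N l k * a k ^ 2 / 2 := by
    intro l k
    nlinarith [mul_nonneg (hN l k) (sq_nonneg (a l - a k))]
  have e1 : ∑ l, ∑ k, N l k * a l ^ 2 / 2 = ∑ l, a l ^ 2 / 2 * ∑ k, N l k := by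
    refine sum_congr rfl fun l _ => ?_
    rw [mul_sum]
    exact sum_congr rfl fun k _ => by ring
  have e2 : ∑ l, ∑ k, N l k * a k ^ 2 / 2 = ∑ k, a k ^ 2 / 2 * ∑ l, N l k := by
    rw [sum_comm]
    refine sum_congr rfl fun k _ => ?_
    rw [mul_sum]
    exact sum_congr rfl fun l _ => by ring
  have b1 : ∑ l, a l ^ 2 / 2 * ∑ k, N l k ≤ ∑ l, a l ^ 2 / 2 * R :=
    sum_le_sum fun l _ => mul_le_mul_of_nonneg_left (hrow l) (by positivity)
  have b2 : ∑ k, a k ^ 2 / 2 * ∑ l, N l k ≤ ∑ k, a k ^ 2 / 2 * R :=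
    sum_le_sum fun k _ => mul_le_mul_of_nonneg_left (hcol k) (by positivity)
  calc ∑ l, ∑ k, a l * N l k * a k
      ≤ ∑ l, ∑ k, (N l k * a l ^ 2 / 2 + N l k * a k ^ 2 / 2) :=
        sum_le_sum fun l _ => sum_le_sum fun k _ => hpt l k
    _ = ∑ l, a l ^ 2 / 2 * ∑ k, N l k + ∑ k, a k ^ 2 / 2 * ∑ l, N l k := by
        rw [← e1, ← e2, ← sum_add_distrib]
        exact sum_congr rfl fun l _ => sum_add_distrib
    _ ≤ ∑ l, a l ^ 2 / 2 * R + ∑ k, a k ^ 2 / 2 * R := add_le_add b1 b2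
    _ = R * ∑ k, a k ^ 2 := by rw [← sum_mul, ← sum_div]; ring

section Entries

variable {ι : Type*}

/-- The EVEN part of the Combes–Thomas perturbation: `‖A_{lk}‖·(cosh(θs) − 1)`, `|s| ≤ dist(l,k)`, vanishes where
`dist(l,k) = 0` and is at most `(cosh θ − 1)‖A_{lk}‖` elsewhere (range one). [folklore] -/
theorem norm_mul_cosh_sub_one_le (dist : ι → ι → ℕ) (A : Matrix ι ι ℂ)
    (hrange : ∀ i j, A i j ≠ 0 → dist i j ≤ 1) {θ : ℝ} (hθ : 0 ≤ θ) (l k : ι) {s : ℝ}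
    (hs : |s| ≤ dist l k) :
    ‖A l k‖ * (Real.cosh (θ * s) - 1) ≤ (Real.cosh θ - 1) * (if dist l k ≠ 0 then ‖A l k‖ else 0) := by
  by_cases hlk : dist l k = 0
  · have hs0 : s = 0 := by
      rw [hlk, Nat.cast_zero] at hs
      exact abs_nonpos_iff.mp hs
    simp [hs0, hlk]
  · rw [if_pos hlk]
    by_cases hA : A l k = 0
    · simp [hA]
    · have h1 : (dist l k : ℝ) ≤ 1 := by exact_mod_cast hrange l k hA
      rw [mul_comm]
      exact mul_le_mul_of_nonneg_right (cosh_mul_sub_one_le hθ (hs.trans h1)) (norm_nonneg _)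

/-- The ODD part against the SKEW part of `A`: `‖A_{lk} − conj A_{kl}‖·|sinh(θs)|`, `|s| ≤ dist(l,k)`, vanishes where
`dist(l,k) = 0` and is at most `sinh θ·‖A_{lk} − conj A_{kl}‖` elsewhere (range one for `A`, symmetric `dist`: at distance
`≥ 2` both `A_{lk}` and `A_{kl}` vanish). [folklore] -/
theorem norm_sub_star_mul_abs_sinh_le (dist : ι → ι → ℕ) (hds : ∀ i j, dist i j = dist j i) (A : Matrix ι ι ℂ)
    (hrange : ∀ i j, A i j ≠ 0 → dist i j ≤ 1) {θ : ℝ} (hθ : 0 ≤ θ) (l k : ι) {s : ℝ}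
    (hs : |s| ≤ dist l k) :
    ‖A l k - star (A k l)‖ * |Real.sinh (θ * s)| ≤
      Real.sinh θ * (if dist l k ≠ 0 then ‖A l k - star (A k l)‖ else 0) := by
  by_cases hlk : dist l k = 0
  · have hs0 : s = 0 := by
      rw [hlk, Nat.cast_zero] at hs
      exact abs_nonpos_iff.mp hs
    simp [hs0, hlk]
  · rw [if_pos hlk]
    by_cases h1 : (dist l k : ℝ) ≤ 1
    · rw [mul_comm]
      exact mul_le_mul_of_nonneg_right (abs_sinh_mul_le hθ (hs.trans h1)) (norm_nonneg _)
    · have hA : A l k = 0 := by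
        by_contra hA; exact h1 (by exact_mod_cast hrange l k hA)
      have hA' : A k l = 0 := by
        by_contra hA'; rw [hds] at h1; exact h1 (by exact_mod_cast hrange k l hA')
      simp [hA, hA']

/-- The distance to a nonempty finite SET, `ρ(k) = min_{y ∈ Y} dist(k,y)`, is `1`-Lipschitz for a symmetric `ℕ`-valued `dist`
satisfying the triangle inequality: `|ρ(l) − ρ(k)| ≤ dist(l,k)` (the block form's Combes–Thomas exponent). [folklore] -/
theorem abs_infDist_sub_infDist_le (dist : ι → ι → ℕ)
    (hds : ∀ i j, dist i j = dist j i) (hdt : ∀ i j k, dist i k ≤ dist i j + dist j k)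
    {Y : Finset ι} (hY : Y.Nonempty) (l k : ι) :
    |((Y.inf' hY fun y => dist l y : ℕ) : ℝ) - ((Y.inf' hY fun y => dist k y : ℕ) : ℝ)| ≤ dist l k := by
  have h1 : ∀ a b : ι, (Y.inf' hY fun y => dist a y) ≤ dist a b + Y.inf' hY fun y => dist b y := by
    intro a b
    obtain ⟨y, hy, hmin⟩ := Finset.exists_mem_eq_inf' hY (fun y => dist b y)
    rw [hmin]
    exact (Finset.inf'_le _ hy).trans (hdt a b y)
  have hlk : ((Y.inf' hY fun y => dist l y : ℕ) : ℝ) ≤ dist l k + ((Y.inf' hY fun y => dist k y : ℕ) : ℝ) := by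
    exact_mod_cast h1 l k
  have hkl : ((Y.inf' hY fun y => dist k y : ℕ) : ℝ) ≤ dist l k + ((Y.inf' hY fun y => dist l y : ℕ) : ℝ) := by
    have := h1 k l
    rw [hds k l] at this
    exact_mod_cast this
  rw [abs_le]
  constructor <;> linarith

end Entries

end Summit.QuantumFields.BalabanUV.T4Continuum.ShellMeasurePropagatorCombesThomasPrelims

end
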